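import Summits.QuantumFields.BalabanUV.Beta.EriceRemainderEnclosureHistoryAutonomyComparisonLoadBudgetWindow

/-!
# EriceRemainderEnclosureHistoryAutonomyComparisonLoadBudgetLevels — (E76b) THE LEVEL-COUPLED LOAD BUDGET: along every box solution of an isotone memory
# with floor dominated by a profile `L ≥ 0`, for EVERY window of scales `i ≤ j` the profile reads of the increments in the window are paid by the level rise
# across it, **`Σ_k x_k·(a_k∕a_j)·(S_{k,j} − S_{k,i})∕k ≤ (1 − a_i∕a_j)∕2`** (`a = 1∕h²`, `x_k = k·L_k·h_k³∕2`, `S_{k,j} = Σ_{l<j} √(k∕(k+l+1))`) — (E65a)'s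
# window budget BEFORE the level ratios `a_k∕a_j` are bounded by `min(1, k∕j)` and `a_i∕a_j` by `0`; so the charge of an older age on a young scale is its
# (E65a) charge AMPLIFIED by the level ratio `a_k∕a_j ≥ 1`, and the level ratios themselves are bounded below by the loads in between
# (`a_k∕a_y − 1 ≥ 2·Σ_{k'} x_{k'}(a_{k'}∕a_y)(S_{k',k} − S_{k',y})∕k'`): the loads of a real flow are coupled through the levels, not only through the budget ½

Cell `pub-balaban`, β-function sub-cell, BINDER row D4 «RemainderConst leaves for Bałaban's split» (`HOME/BINDER-OWNERS.md`; owner lineage `b2b-balaban-beta-an4`;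
this file by co-owner #2 lineage `b2b-balaban-beta-d4-p2`, generation 67), β-FLOW TEAM duty (1), FREEZE (0) honoured (def-free; imports (E65a) `…LoadBudgetWindow`;
uses (E58b) `mul_sqrt_le_read`, (E48a) `strictAnti_of_memFlow`, node U2's `invSq_eq_of_memFlow` ∕ `drive` ∕ `seqBox_shift`, (E65a) `readWindow_nonneg` BY NAME;
nothing restated).

HONEST FRAMING (page 1, verbatim and binding).  *"Discharging BetaPertH makes Bałaban's UV stability UNCONDITIONAL — a real constructive-QFT result; it is
NOT the continuum limit and NOT the Clay problem."*  THIS FILE DISCHARGES NOTHING OF THE KIND.  Elementary real analysis about ABSTRACT functionals on a box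
]0,γ]^ℕ with displayed floors, profiles and signs — hypotheses of a census, not facts; the form, signs, ages and moments of Bałaban's (1.22) limit functional
are NOT PRINTED ([I] p. 298; GAPS G-t4-U2-1∕-2) and NOT asserted.  Row D4 class UNCHANGED (critical-path width 0; instance 0∕1; D4 DISCHARGE NO DATE).  HONEST
DEPENDENCY: continuum YM on T⁴ ⇐ BetaPertH ∧ nine spine estimates (0/9 proved); BetaPertH ⇐ (D1) ∧ (D4) ∧ CAP+tail; G-an2-4 gates asym, D1 and NE2/3/4.

THE POINT (README `HOME/b2b-balaban-beta-d4-p2/g67/e76/README.md` §5; route (N)).  Every station since g62 has run the static chain over (E65a)'s window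
POLYTOPE `{x ≥ 0 : Σ_k c_j(k)x_k ≤ ½ ∀j}` («flow-free»), whose adversarial suprema (window-mass chain, continuum: `sup ρ ≈ 0.66–0.70`, `sup x·V ≈ 0.19–0.22`)
are carried by «dense block just above the young + thin far pump» configurations — while on every REAL flow computed since g62 the chain's worst case is
the LONE young age (`ρ` = its lone load; g62 §PS2∕PS4, and g67's `job22/blockscan`: adding a block or a pump to a lone young LOWERS `ρ_y`).  The reason is
in (E65a)'s own proof: `1∕h_j² ≥ Σ_{l<j} D_l ≥ Σ_k L_k·h_k·S_{k,j}` and then `L_k h_k = 2x_k·a_k∕k` with `a_k∕a_j` replaced by `1` (`k > j`) or `k∕j` (`k ≤ j`):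
the level ratio `a_k∕a_j ≥ 1` of an older age is DISCARDED.  But `a_k∕a_j − 1` is itself bounded below by the reads of every age on the window `[j, k)` —
including the young's own and the block's (§2 with the window `[j,k)`): in the polytope's maximisers (young `x ≈ 0.16–0.35`, block `≈ 0.3` at ratio `≤ 1.14`,
pump at ratios `2–8`) the pump's charges on the young are amplified `2–3×`, which is what real flows show (g67 `job22`).  This file proves the budget with
the level ratios KEPT, for every window `[i, j)`: the realisable load vectors satisfy a LEVEL-COUPLED system — loads `x` AND levels `a`, `a_j − a_i ≥
2Σ_k x_k a_k (S_{k,j} − S_{k,i})∕k` — of which the polytope is the projection that forgets `a`.  NOT CLAIMED: the static closure over the level-coupled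
system (numerics: README §5); anything nonlinear; anything printed.

WHAT IS PROVED ([folklore]; 0 `def`, 0 sorry).  §1 `readWindowIco_nonneg`, **`sum_mul_readWindowIco_le_level_rise`** (`Σ_k L_k·h_k·Σ_{i≤l<j}√(k∕(k+l+1)) ≤
1∕h_j² − 1∕h_i²`).  §2 **`load_budget_levels`** (`Σ_k (L_k·k·h_k³)·(h_j∕h_k)²·(S_{k,j} − S_{k,i})∕k ≤ 1 − (h_j∕h_i)²` for `i ≤ j` — the loads `2x_k` with
the level ratios `a_k∕a_j = (h_j∕h_k)²`), `load_budget_levels_pin` (the window `[0, j)`), **`level_ratio_ge`** (`(h_y∕h_k)² − 1 ≥ Σ_{k'} (L·k'·h³)(h_y∕h_{k'})²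
(S_{k',k} − S_{k',y})∕k'` for `y ≤ k`: the amplification of an older age's level by the loads in between), `level_ratio_ge_one` (`(h_j∕h_k)² ≥ 1` for
`k ≥ j`: the discarded factor is at least one, so §2 implies (E65a) `load_budget_window` for the older ages termwise).
-/
noncomputable section
open Finset Set

namespace Summit.QuantumFields.BalabanUV.Beta.EriceRemainderEnclosureHistoryAutonomyComparisonLoadBudgetLevels

open Literature.MathematicalPhysics.QuantumFieldTheory.Balaban1983to89
open Literature.MathematicalPhysics.QuantumFieldTheory.Balaban1983to89.T4BetaStationary
open Literature.MathematicalPhysics.QuantumFieldTheory.Balaban1983to89.T4BetaFlowWellPosed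
open Summit.QuantumFields.BalabanUV.Beta.EriceRemainderEnclosureHistoryAutonomyOrder (strictAnti_of_memFlow)
open Summit.QuantumFields.BalabanUV.Beta.EriceRemainderEnclosureHistoryAutonomyComparisonAffineProfile (mul_sqrt_le_read)
open Summit.QuantumFields.BalabanUV.Beta.EriceRemainderEnclosureHistoryAutonomyComparisonLoadBudgetWindow (readWindow_nonneg)

variable {B : (ℕ → ℝ) → ℝ} {γ b y : ℝ} {L : ℕ → ℝ} {K : ℕ} {h : ℕ → ℝ}

/-! ## §1 The reads of a window of increments are paid by the level rise across the window -/

/-- The windowed read sum `Σ_{i≤l<j} √(k∕(k+l+1))` is non-negative. [folklore] -/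
theorem readWindowIco_nonneg (k i j : ℕ) : 0 ≤ ∑ l ∈ Ico i j, Real.sqrt ((k : ℝ) / ((k : ℝ) + l + 1)) :=
  sum_nonneg fun _ _ => Real.sqrt_nonneg _

/-- **THE LEVEL RISE ACROSS A WINDOW PAYS THE PROFILE READS IN IT.**  `B` isotone with floor `b > 0`, dominated by the profile `L ≥ 0`; along every box
solution `h` from a pin `y > 0`, for all scales `i ≤ j`: `Σ_{k<K} L_k·h_k·Σ_{i≤l<j} √(k∕(k+l+1)) ≤ 1∕h_j² − 1∕h_i²` — the increments `l ∈ [i,j)` of `1∕h²`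
are memory terms `≥ Σ_k L_k·h_{l+1+k}` (domination), and each read is `≥ √(k∕(k+l+1))·h_k` ((E58b) `mul_sqrt_le_read`).  (E65a) `sum_mul_readWindow_le_invSq`
is the window `[0,j)` with `1∕h_0²` dropped. [folklore] -/
theorem sum_mul_readWindowIco_le_level_rise (hmono : ∀ u v : ℕ → ℝ, SeqBox γ u → SeqBox γ v → (∀ j, u j ≤ v j) → B u ≤ B v)
    (hL : ∀ k, 0 ≤ L k) (hb : 0 < b) (hlo : ∀ u, SeqBox γ u → b ≤ B u) (hdom : ∀ u, SeqBox γ u → ∑ k ∈ range K, L k * u k ≤ B u)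
    (hy : 0 < y) (hh : SeqBox γ h) (hf : MemFlow B y h) {i j : ℕ} (hij : i ≤ j) :
    ∑ k ∈ range K, L k * h k * ∑ l ∈ Ico i j, Real.sqrt ((k : ℝ) / ((k : ℝ) + l + 1)) ≤ 1 / h j ^ 2 - 1 / h i ^ 2 := by
  have hrise : 1 / h j ^ 2 - 1 / h i ^ 2 = ∑ l ∈ Ico i j, B (fun j' => h (l + 1 + j')) := by
    rw [invSq_eq_of_memFlow hf j, invSq_eq_of_memFlow hf i]
    unfold drive
    rw [sum_Ico_eq_sub _ hij]
    ring
  have hdomw : ∑ l ∈ Ico i j, ∑ k ∈ range K, L k * h (l + 1 + k) ≤ ∑ l ∈ Ico i j, B (fun j' => h (l + 1 + j')) :=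
    sum_le_sum fun l _ => hdom _ (seqBox_shift hh (l + 1))
  have hterm : ∀ k ∈ range K, L k * h k * ∑ l ∈ Ico i j, Real.sqrt ((k : ℝ) / ((k : ℝ) + l + 1)) ≤ ∑ l ∈ Ico i j, L k * h (l + 1 + k) := by
    intro k _
    rw [mul_sum]
    refine sum_le_sum fun l _ => ?_
    have hr := mul_sqrt_le_read hmono hb hlo hy hh hf k (l + 1)
    rw [show k + (l + 1) = l + 1 + k by omega] at hr
    have e : ((k : ℝ) + ((l + 1 : ℕ) : ℝ)) = (k : ℝ) + l + 1 := by push_cast; ring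
    rw [e] at hr
    calc L k * h k * Real.sqrt ((k : ℝ) / ((k : ℝ) + l + 1)) = L k * (Real.sqrt ((k : ℝ) / ((k : ℝ) + l + 1)) * h k) := by ring
      _ ≤ L k * h (l + 1 + k) := mul_le_mul_of_nonneg_left hr (hL k)
  calc ∑ k ∈ range K, L k * h k * ∑ l ∈ Ico i j, Real.sqrt ((k : ℝ) / ((k : ℝ) + l + 1))
      ≤ ∑ k ∈ range K, ∑ l ∈ Ico i j, L k * h (l + 1 + k) := sum_le_sum hterm
    _ = ∑ l ∈ Ico i j, ∑ k ∈ range K, L k * h (l + 1 + k) := sum_comm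
    _ ≤ ∑ l ∈ Ico i j, B (fun j' => h (l + 1 + j')) := hdomw
    _ = 1 / h j ^ 2 - 1 / h i ^ 2 := hrise.symm

/-! ## §2 The level-coupled budget in load letters, and the amplification of older levels -/

/-- **THE LEVEL-COUPLED LOAD BUDGET.**  Same hypotheses; for all scales `i ≤ j`:
`Σ_{k<K} (L_k·k·h_k³)·(h_j∕h_k)²·(Σ_{i≤l<j} √(k∕(k+l+1)))∕k ≤ 1 − (h_j∕h_i)²` — with the loads `x_k = k·L_k·h_k³∕2` and the levels `a = 1∕h²`:
`2·Σ_k x_k·(a_k∕a_j)·(S_{k,j} − S_{k,i})∕k ≤ 1 − a_i∕a_j`.  (E65a) `load_budget_window` is the case `i = 0` after `a_0∕a_j ≥ 0`, `a_k∕a_j ≥ 1` (`k > j`) and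
`a_k∕a_j ≥ k∕j` (`k ≤ j`); here the level ratios are kept. [folklore] -/
theorem load_budget_levels (hmono : ∀ u v : ℕ → ℝ, SeqBox γ u → SeqBox γ v → (∀ j, u j ≤ v j) → B u ≤ B v)
    (hL : ∀ k, 0 ≤ L k) (hb : 0 < b) (hlo : ∀ u, SeqBox γ u → b ≤ B u) (hdom : ∀ u, SeqBox γ u → ∑ k ∈ range K, L k * u k ≤ B u)
    (hy : 0 < y) (hh : SeqBox γ h) (hf : MemFlow B y h) {i j : ℕ} (hij : i ≤ j) :
    ∑ k ∈ range K, L k * k * h k ^ 3 * ((h j / h k) ^ 2 * ((∑ l ∈ Ico i j, Real.sqrt ((k : ℝ) / ((k : ℝ) + l + 1))) / k)) ≤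
      1 - (h j / h i) ^ 2 := by
  have hw := sum_mul_readWindowIco_le_level_rise hmono hL hb hlo hdom hy hh hf hij
  have hhj := (hh j).1
  have hhi := (hh i).1
  -- multiply §1 by `h_j² > 0`
  have hmul := mul_le_mul_of_nonneg_left hw (le_of_lt (pow_pos hhj 2))
  have erhs : h j ^ 2 * (1 / h j ^ 2 - 1 / h i ^ 2) = 1 - (h j / h i) ^ 2 := by
    field_simp
  rw [erhs, mul_sum] at hmul
  refine le_trans (le_of_eq (sum_congr rfl fun k _ => ?_)) hmul
  -- termwise identity (the `k = 0` term vanishes on both sides)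
  have hhk := (hh k).1
  rcases Nat.eq_zero_or_pos k with rfl | hkpos
  · simp
  · have hkr : (k : ℝ) * h k ^ 2 ≠ 0 := by positivity
    rw [div_pow, show L k * (k : ℝ) * h k ^ 3 * (h j ^ 2 / h k ^ 2 * ((∑ l ∈ Ico i j, Real.sqrt ((k : ℝ) / ((k : ℝ) + l + 1))) / k)) =
      h j ^ 2 * (L k * h k * ∑ l ∈ Ico i j, Real.sqrt ((k : ℝ) / ((k : ℝ) + l + 1))) * ((k : ℝ) * h k ^ 2 / ((k : ℝ) * h k ^ 2)) by ring,
      div_self hkr, mul_one]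

/-- The window `[0, j)`: `Σ_k (L_k·k·h_k³)·(h_j∕h_k)²·S_{k,j}∕k ≤ 1 − (h_j∕h_0)²` — (E65a)'s budget with the level ratios and the pin term kept. [folklore] -/
theorem load_budget_levels_pin (hmono : ∀ u v : ℕ → ℝ, SeqBox γ u → SeqBox γ v → (∀ j, u j ≤ v j) → B u ≤ B v)
    (hL : ∀ k, 0 ≤ L k) (hb : 0 < b) (hlo : ∀ u, SeqBox γ u → b ≤ B u) (hdom : ∀ u, SeqBox γ u → ∑ k ∈ range K, L k * u k ≤ B u)
    (hy : 0 < y) (hh : SeqBox γ h) (hf : MemFlow B y h) (j : ℕ) :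
    ∑ k ∈ range K, L k * k * h k ^ 3 * ((h j / h k) ^ 2 * ((∑ l ∈ range j, Real.sqrt ((k : ℝ) / ((k : ℝ) + l + 1))) / k)) ≤
      1 - (h j / h 0) ^ 2 := by
  have h0 := load_budget_levels hmono hL hb hlo hdom hy hh hf (Nat.zero_le j)
  simpa only [range_eq_Ico] using h0

/-- **THE AMPLIFICATION OF AN OLDER LEVEL BY THE LOADS IN BETWEEN.**  For scales `y ≤ k`: `(h_y∕h_k)² − 1 ≥ Σ_{k'<K} (L_{k'}·k'·h_{k'}³)·(h_y∕h_{k'})²·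
(Σ_{y≤l<k} √(k'∕(k'+l+1)))∕k'` — in level letters `a_k∕a_y − 1 ≥ 2Σ_{k'} x_{k'}(a_{k'}∕a_y)(S_{k',k} − S_{k',y})∕k'`: every age's reads on `[y, k)` (the
young's own, a block's, a pump's) raise the level of the older age `k` relative to the young `y`, hence its charge `(a_k∕a_y)·S_{k,y}∕k` in
`load_budget_levels`. [folklore] -/
theorem level_ratio_ge (hmono : ∀ u v : ℕ → ℝ, SeqBox γ u → SeqBox γ v → (∀ j, u j ≤ v j) → B u ≤ B v)
    (hL : ∀ k, 0 ≤ L k) (hb : 0 < b) (hlo : ∀ u, SeqBox γ u → b ≤ B u) (hdom : ∀ u, SeqBox γ u → ∑ k ∈ range K, L k * u k ≤ B u)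
    (hy : 0 < y) (hh : SeqBox γ h) (hf : MemFlow B y h) {y' k : ℕ} (hyk : y' ≤ k) :
    ∑ k' ∈ range K, L k' * k' * h k' ^ 3 * ((h y' / h k') ^ 2 * ((∑ l ∈ Ico y' k, Real.sqrt ((k' : ℝ) / ((k' : ℝ) + l + 1))) / k')) ≤
      (h y' / h k) ^ 2 - 1 := by
  have hw := sum_mul_readWindowIco_le_level_rise hmono hL hb hlo hdom hy hh hf hyk
  have hhy := (hh y').1
  have hhk := (hh k).1
  have hmul := mul_le_mul_of_nonneg_left hw (le_of_lt (pow_pos hhy 2))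
  have erhs : h y' ^ 2 * (1 / h k ^ 2 - 1 / h y' ^ 2) = (h y' / h k) ^ 2 - 1 := by
    field_simp
  rw [erhs, mul_sum] at hmul
  refine le_trans (le_of_eq (sum_congr rfl fun k' _ => ?_)) hmul
  have hhk' := (hh k').1
  rcases Nat.eq_zero_or_pos k' with rfl | hkpos
  · simp
  · have hkr : (k' : ℝ) * h k' ^ 2 ≠ 0 := by positivity
    rw [div_pow, show L k' * (k' : ℝ) * h k' ^ 3 * (h y' ^ 2 / h k' ^ 2 * ((∑ l ∈ Ico y' k, Real.sqrt ((k' : ℝ) / ((k' : ℝ) + l + 1))) / k')) =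
      h y' ^ 2 * (L k' * h k' * ∑ l ∈ Ico y' k, Real.sqrt ((k' : ℝ) / ((k' : ℝ) + l + 1))) * ((k' : ℝ) * h k' ^ 2 / ((k' : ℝ) * h k' ^ 2)) by ring,
      div_self hkr, mul_one]

/-- The discarded factor is at least one: `(h_j∕h_k)² ≥ 1` for `k ≥ j` along the (strictly decreasing) trajectory — so each older-age term of
`load_budget_levels_pin` dominates the corresponding term `(L_k·k·h_k³)·S_{k,j}∕k` of (E65a) `load_budget_window`. [folklore] -/
theorem level_ratio_ge_one (hb : 0 < b) (hlo : ∀ u, SeqBox γ u → b ≤ B u) (hh : SeqBox γ h) (hf : MemFlow B y h) {j k : ℕ} (hjk : j ≤ k) :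
    1 ≤ (h j / h k) ^ 2 := by
  have hanti := (strictAnti_of_memFlow hb hlo hh hf).antitone hjk
  have hhk := (hh k).1
  have h1 : 1 ≤ h j / h k := by rw [le_div_iff₀ hhk, one_mul]; exact hanti
  nlinarith

/-! ## §3 (append, gen 67) The young's budget with its own amplification of the older charges -/

/-- **THE YOUNG'S AMPLIFIED BUDGET.**  Same hypotheses; a young age `y' < K` and the older ages `k > y'` of the profile: with `X_k = L_k·k·h_k³` (`= 2x_k`),
`S_{k,j} = Σ_{l<j} √(k∕(k+l+1))`:  **`X_{y'}·S_{y',y'}∕y' + Σ_{y'<k<K} X_k·(S_{k,y'}∕k)·(1 + X_{y'}·(S_{y',k} − S_{y',y'})∕y') ≤ 1`** — the young's own reads on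
`[y', k)` raise the level of every older age `k` (`level_ratio_ge`, the `k' = y'` term), so every older charge `S_{k,y'}∕k` of (E65a) is multiplied by
`1 + X_{y'}(S_{y',k} − S_{y',y'})∕y' ≈ 1 + 2X_{y'}(√(1+k∕y') − √2)`: the young's EFFECTIVE own charge is `S_{y',y'}∕y' + Σ_{k>y'} X_k(S_{k,y'}∕k)(S_{y',k}−S_{y',y'})∕y'`.
(From `load_budget_levels_pin` at `j = y'`, dropping the ages `< y'`, the pin term and the other ages' amplification.) [folklore] -/
theorem young_budget_amplified (hmono : ∀ u v : ℕ → ℝ, SeqBox γ u → SeqBox γ v → (∀ j, u j ≤ v j) → B u ≤ B v)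
    (hL : ∀ k, 0 ≤ L k) (hb : 0 < b) (hlo : ∀ u, SeqBox γ u → b ≤ B u) (hdom : ∀ u, SeqBox γ u → ∑ k ∈ range K, L k * u k ≤ B u)
    (hy : 0 < y) (hh : SeqBox γ h) (hf : MemFlow B y h) {y' : ℕ} (hy'K : y' < K) :
    L y' * y' * h y' ^ 3 * ((∑ l ∈ range y', Real.sqrt ((y' : ℝ) / ((y' : ℝ) + l + 1))) / y') +
      ∑ k ∈ (range K).filter (fun k => y' < k), L k * k * h k ^ 3 * ((∑ l ∈ range y', Real.sqrt ((k : ℝ) / ((k : ℝ) + l + 1))) / k) *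
        (1 + L y' * y' * h y' ^ 3 * ((∑ l ∈ Ico y' k, Real.sqrt ((y' : ℝ) / ((y' : ℝ) + l + 1))) / y')) ≤ 1 := by
  set T : ℕ → ℝ := fun k => L k * k * h k ^ 3 * ((h y' / h k) ^ 2 * ((∑ l ∈ range y', Real.sqrt ((k : ℝ) / ((k : ℝ) + l + 1))) / k)) with hT
  have htot : ∑ k ∈ range K, T k ≤ 1 := by
    have h1 := load_budget_levels_pin hmono hL hb hlo hdom hy hh hf y'
    have h2 : 0 ≤ (h y' / h 0) ^ 2 := sq_nonneg _
    simpa only [hT] using h1.trans (by linarith)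
  have hX0 : ∀ k, 0 ≤ L k * k * h k ^ 3 := fun k => mul_nonneg (mul_nonneg (hL k) (Nat.cast_nonneg k)) (pow_nonneg (hh k).1.le 3)
  have hT0 : ∀ k ∈ range K, 0 ≤ T k := fun k _ =>
    mul_nonneg (hX0 k) (mul_nonneg (sq_nonneg _) (div_nonneg (readWindow_nonneg k y') (Nat.cast_nonneg k)))
  have hsplit : ∑ k ∈ range K, T k = ∑ k ∈ (range K).filter (fun k => y' < k), T k + ∑ k ∈ (range K).filter (fun k => ¬ y' < k), T k :=
    (sum_filter_add_sum_filter_not _ _ _).symm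
  -- the young's own term
  have hyy : (h y' / h y') ^ 2 = 1 := by rw [div_self (hh y').1.ne', one_pow]
  have hyoung : L y' * y' * h y' ^ 3 * ((∑ l ∈ range y', Real.sqrt ((y' : ℝ) / ((y' : ℝ) + l + 1))) / y') ≤
      ∑ k ∈ (range K).filter (fun k => ¬ y' < k), T k := by
    have hmem : y' ∈ (range K).filter (fun k => ¬ y' < k) := mem_filter.mpr ⟨mem_range.mpr hy'K, lt_irrefl y'⟩
    have h1 : T y' ≤ ∑ k ∈ (range K).filter (fun k => ¬ y' < k), T k :=
      single_le_sum (fun k hk => hT0 k (mem_filter.mp hk).1) hmem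
    have e : T y' = L y' * y' * h y' ^ 3 * ((∑ l ∈ range y', Real.sqrt ((y' : ℝ) / ((y' : ℝ) + l + 1))) / y') := by
      simp only [hT, hyy, one_mul]
    rw [← e]; exact h1
  -- each older term, amplified by the young's own reads on `[y', k)`
  have hold : ∀ k ∈ (range K).filter (fun k => y' < k),
      L k * k * h k ^ 3 * ((∑ l ∈ range y', Real.sqrt ((k : ℝ) / ((k : ℝ) + l + 1))) / k) *
        (1 + L y' * y' * h y' ^ 3 * ((∑ l ∈ Ico y' k, Real.sqrt ((y' : ℝ) / ((y' : ℝ) + l + 1))) / y')) ≤ T k := by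
    intro k hk
    obtain ⟨hkK, hyk⟩ := mem_filter.mp hk
    have hamp := level_ratio_ge hmono hL hb hlo hdom hy hh hf hyk.le
    -- the `k' = y'` term of the amplification sum
    have hterm : L y' * y' * h y' ^ 3 * ((∑ l ∈ Ico y' k, Real.sqrt ((y' : ℝ) / ((y' : ℝ) + l + 1))) / y') ≤
        ∑ k' ∈ range K, L k' * k' * h k' ^ 3 * ((h y' / h k') ^ 2 * ((∑ l ∈ Ico y' k, Real.sqrt ((k' : ℝ) / ((k' : ℝ) + l + 1))) / k')) := by
      have h1 := single_le_sum (f := fun k' => L k' * k' * h k' ^ 3 * ((h y' / h k') ^ 2 * ((∑ l ∈ Ico y' k, Real.sqrt ((k' : ℝ) / ((k' : ℝ) + l + 1))) / k')))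
        (fun k' _ => mul_nonneg (hX0 k') (mul_nonneg (sq_nonneg _) (div_nonneg (readWindowIco_nonneg k' y' k) (Nat.cast_nonneg k')))) (mem_range.mpr hy'K)
      simp only [hyy, one_mul] at h1
      exact h1
    have hg : 1 + L y' * y' * h y' ^ 3 * ((∑ l ∈ Ico y' k, Real.sqrt ((y' : ℝ) / ((y' : ℝ) + l + 1))) / y') ≤ (h y' / h k) ^ 2 := by
      linarith [hterm, hamp]
    have hA0 : 0 ≤ 1 + L y' * y' * h y' ^ 3 * ((∑ l ∈ Ico y' k, Real.sqrt ((y' : ℝ) / ((y' : ℝ) + l + 1))) / y') :=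
      add_nonneg zero_le_one (mul_nonneg (hX0 y') (div_nonneg (readWindowIco_nonneg y' y' k) (Nat.cast_nonneg y')))
    have hS0 : 0 ≤ (∑ l ∈ range y', Real.sqrt ((k : ℝ) / ((k : ℝ) + l + 1))) / k := div_nonneg (readWindow_nonneg k y') (Nat.cast_nonneg k)
    calc L k * k * h k ^ 3 * ((∑ l ∈ range y', Real.sqrt ((k : ℝ) / ((k : ℝ) + l + 1))) / k) *
          (1 + L y' * y' * h y' ^ 3 * ((∑ l ∈ Ico y' k, Real.sqrt ((y' : ℝ) / ((y' : ℝ) + l + 1))) / y'))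
        ≤ L k * k * h k ^ 3 * ((∑ l ∈ range y', Real.sqrt ((k : ℝ) / ((k : ℝ) + l + 1))) / k) * (h y' / h k) ^ 2 :=
          mul_le_mul_of_nonneg_left hg (mul_nonneg (hX0 k) hS0)
      _ = T k := by simp only [hT]; ring
  calc L y' * y' * h y' ^ 3 * ((∑ l ∈ range y', Real.sqrt ((y' : ℝ) / ((y' : ℝ) + l + 1))) / y') +
        ∑ k ∈ (range K).filter (fun k => y' < k), L k * k * h k ^ 3 * ((∑ l ∈ range y', Real.sqrt ((k : ℝ) / ((k : ℝ) + l + 1))) / k) *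
          (1 + L y' * y' * h y' ^ 3 * ((∑ l ∈ Ico y' k, Real.sqrt ((y' : ℝ) / ((y' : ℝ) + l + 1))) / y'))
      ≤ ∑ k ∈ (range K).filter (fun k => ¬ y' < k), T k + ∑ k ∈ (range K).filter (fun k => y' < k), T k :=
        add_le_add hyoung (sum_le_sum hold)
    _ = ∑ k ∈ range K, T k := by rw [hsplit, add_comm]
    _ ≤ 1 := htot

/-! ## §4 (append, gen 67) At every pin: the level-coupled budget and the young's amplified budget on the tail flow -/

/-- **THE LEVEL-COUPLED BUDGET AT EVERY PIN.**  Along a box solution `h` from any pin `gIR`, the tail `h(m+·)` is a box solution from `h_m` ((E48a)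
`memFlow_tail`), so `load_budget_levels` holds with `h ↦ h(m+·)`: for all `i ≤ j`,
`Σ_k (L_k·k·h_{m+k}³)·(h_{m+j}∕h_{m+k})²·(S_{k,j} − S_{k,i})∕k ≤ 1 − (h_{m+j}∕h_{m+i})²` — the loads `x_k(m) = k·L_k·h_{m+k}³∕2` of the static chain at the pin `m`
((E75a) `load_budget_window_at_pin` is the projection). [folklore] -/
theorem load_budget_levels_at_pin (hmono : ∀ u v : ℕ → ℝ, SeqBox γ u → SeqBox γ v → (∀ j, u j ≤ v j) → B u ≤ B v)
    (hL : ∀ k, 0 ≤ L k) (hb : 0 < b) (hlo : ∀ u, SeqBox γ u → b ≤ B u) (hdom : ∀ u, SeqBox γ u → ∑ k ∈ range K, L k * u k ≤ B u)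
    {gIR : ℝ} (hh : SeqBox γ h) (hf : MemFlow B gIR h) (m : ℕ) {i j : ℕ} (hij : i ≤ j) :
    ∑ k ∈ range K, L k * k * h (m + k) ^ 3 * ((h (m + j) / h (m + k)) ^ 2 * ((∑ l ∈ Ico i j, Real.sqrt ((k : ℝ) / ((k : ℝ) + l + 1))) / k)) ≤
      1 - (h (m + j) / h (m + i)) ^ 2 :=
  load_budget_levels hmono hL hb hlo hdom (hh m).1 (seqBox_shift hh m) (EriceRemainderEnclosureHistoryAutonomyOrder.memFlow_tail hf m) hij

/-- **THE YOUNG'S AMPLIFIED BUDGET AT EVERY PIN** (`young_budget_amplified` on the tail flow from `h_m`): for a young age `y' < K`,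
`X_{y'}(m) S_{y',y'}∕y' + Σ_{y'<k<K} X_k(m)(S_{k,y'}∕k)(1 + X_{y'}(m)(S_{y',k} − S_{y',y'})∕y') ≤ 1` with `X_k(m) = L_k·k·h_{m+k}³ = 2x_k(m)`. [folklore] -/
theorem young_budget_amplified_at_pin (hmono : ∀ u v : ℕ → ℝ, SeqBox γ u → SeqBox γ v → (∀ j, u j ≤ v j) → B u ≤ B v)
    (hL : ∀ k, 0 ≤ L k) (hb : 0 < b) (hlo : ∀ u, SeqBox γ u → b ≤ B u) (hdom : ∀ u, SeqBox γ u → ∑ k ∈ range K, L k * u k ≤ B u)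
    {gIR : ℝ} (hh : SeqBox γ h) (hf : MemFlow B gIR h) (m : ℕ) {y' : ℕ} (hy'K : y' < K) :
    L y' * y' * h (m + y') ^ 3 * ((∑ l ∈ range y', Real.sqrt ((y' : ℝ) / ((y' : ℝ) + l + 1))) / y') +
      ∑ k ∈ (range K).filter (fun k => y' < k), L k * k * h (m + k) ^ 3 * ((∑ l ∈ range y', Real.sqrt ((k : ℝ) / ((k : ℝ) + l + 1))) / k) *
        (1 + L y' * y' * h (m + y') ^ 3 * ((∑ l ∈ Ico y' k, Real.sqrt ((y' : ℝ) / ((y' : ℝ) + l + 1))) / y')) ≤ 1 :=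
  young_budget_amplified hmono hL hb hlo hdom (hh m).1 (seqBox_shift hh m) (EriceRemainderEnclosureHistoryAutonomyOrder.memFlow_tail hf m) hy'K

end Summit.QuantumFields.BalabanUV.Beta.EriceRemainderEnclosureHistoryAutonomyComparisonLoadBudgetLevels

end
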